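import Summits.FinalStateConjecture.FinalStateConjecture.Theorems.BartnikGapSettlingBondiBartnikRigiditySlabCauchyRigidityDefs
import Summits.FinalStateConjecture.FinalStateConjecture.Theorems.SwallowTheDatumSubdataDevelopmentsEmbedNcbDomain
import Summits.FinalStateConjecture.FinalStateConjecture.Theorems.SwallowTheDatumSubdataDevelopmentsEmbedHmaxGlue
import Summits.FinalStateConjecture.FinalStateConjecture.Theorems.SwallowTheDatumSubdataDevelopmentsEmbedRealise
import Summits.FinalStateConjecture.FinalStateConjecture.Theorems.PhaseMixingCaptureCaptureSufficesC2StubHypersurfaceMGHDRealisedRealise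
import Literature.Geometry.Lorentzian.CauchyDevelopmentGlobalHyperbolicityProofs
import Literature.Geometry.Lorentzian.DataEmbeddingConstraints
import HarnessLib

/-!
# F1' `stub_slabCauchyRigidity'`, step (d): the localisation principle in Literature vocabulary
# (`SubdataDevelopmentsEmbedLit`) from MGHD existence — line `direct-method-on-the-cone`,
# crux `BondiBartnikRigidity` (stmt-FinalStateConjecture-10807); module 4 of the landing of the
# conditional proof of F1'

The route statement (D) `F1Route.SubdataDevelopmentsEmbedLit` of `…SlabCauchyRigidityDefs.lean` is,
verbatim, the body of route item `SubdataDevelopmentsEmbed` (stmt-FinalStateConjecture-10053) of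
route `SwallowTheDatum`, which the tree closes CONDITIONALLY on the single named fact
`choquetBruhat_geroch_exists_mghd_cauchy` in
`Theorems/SwallowTheDatumSubdataDevelopmentsEmbedLocalisationHolds.lean` — but over the THESES name,
which a Theorems file of another route does not import.  This file re-derives the same closing line
over the Literature-vocabulary statement, by ADAPTING (verbatim, `-- adapted from …` below) the
declarations of `…SubdataDevelopmentsEmbedLocalisation.lean` whose import closure contains
the Theses module (`not_clusterPt_map_of_mem`,
`subdataDevelopmentsEmbed_of_choquetBruhatGeroch_of_causalCompact`) and the ten-line
`exists_isMaximal_of_nonempty_of_choquetBruhatGeroch` of `…SubdataDevelopmentsEmbed.lean`; the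
realisation step is the tree's `CaptureSufficesC2.Sketch.exists_realised_into`
(`…StubHypersurfaceMGHDRealisedRealise.lean`, the spacetime-valued form of `exists_realised_rel`);
every other ingredient (`…NcbDomain`, `…HmaxGlue`, `…Realise`, the Literature gluing files) is imported.

* `subdataDevelopmentsEmbedLit_of_choquetBruhatGeroch :
    choquetBruhat_geroch_exists_mghd_cauchy → SubdataDevelopmentsEmbedLit`, registered bookkeeping
  sub-goal `stub_subdataDevelopmentsEmbedLit` of the line.

References: Hawking–Ellis 1973, §7.6, pp. 249–251 [HawkingEllis1973CUP]; Choquet-Bruhat–Geroch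
1969, Thm. 3 and p. 334 [ChoquetBruhatGeroch1969CMP]; Sbierski 2016, §2, Def. 2.4 [Sbierski2016AHP].
No definitions, no new named facts (the MGHD existence fact stays a hypothesis).
-/

noncomputable section

-- D-0017: single-problem summit, `Summit.<S>.<S>.…` by design (cf. lakefile `weak.linter.dupNamespace`).
set_option linter.dupNamespace false

open Function Set Filter Topology TopologicalSpace Bundle
open scoped Manifold ContDiff Topology

namespace Summit.FinalStateConjecture.FinalStateConjecture.Theorems.BondiBartnikRigidity.DirectMethod

namespace F1Route

open Literature.Geometry.Lorentzian
open Summit.FinalStateConjecture.FinalStateConjecture.Theorems.SubdataDevelopmentsEmbed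
open Summit.FinalStateConjecture.FinalStateConjecture.Theorems.CaptureSufficesC2.Sketch (exists_realised_into)

-- adapted from `Theorems/SwallowTheDatumSubdataDevelopmentsEmbed.lean`
-- (`exists_isMaximal_of_nonempty_of_choquetBruhatGeroch`, verbatim)
/-- **MGHD existence for developable data, from the named fact** `choquetBruhat_geroch_exists_mghd_cauchy`
(Choquet-Bruhat–Geroch 1969, Thm. 3): the data of a vacuum Cauchy development solve the constraints
(`InitialDataSet.isVacuumConstraintSolution_of_dataEmbedding`). [cite: ChoquetBruhatGeroch1969CMP, Thm. 3] -/
private theorem exists_isMaximal_of_nonempty_of_choquetBruhatGeroch'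
    (h : choquetBruhat_geroch_exists_mghd_cauchy) (X : Type) [TopologicalSpace X]
    [ChartedSpace E3 X] [IsManifold (𝓡 3) ∞ X] [T2Space X] [SecondCountableTopology X]
    [ConnectedSpace X] (D : InitialDataSet (𝓡 3) X) (hD : Nonempty (VacuumCauchyDevelopment D)) :
    ∃ 𝒟 : VacuumCauchyDevelopment D, 𝒟.IsMaximal := by
  obtain ⟨𝒟₀⟩ := hD
  haveI := D.metric.hasLeviCivita
  exact h X D (InitialDataSet.isVacuumConstraintSolution_of_dataEmbedding 𝒟₀.toDataEmbedding
    𝒟₀.isVacuum fun x ↦ 𝒟₀.contMDiffAt_embed_normal x)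

-- adapted from `Theorems/SwallowTheDatumSubdataDevelopmentsEmbedLocalisation.lean`
-- (`not_clusterPt_map_of_mem`, `exists_realised_rel`: verbatim)
/-- **An injective map which is open on the open set `U` has no cluster value `ψ y₀`, `y₀ ∈ U`,
along `U` at a point of the frontier of `U`**: a closed neighbourhood `B ⊆ U` of `y₀` has
`ψ(int B ∩ U)` as a neighbourhood of `ψ y₀`, points of `U` near `p` mapped into it lie in `B`
(injectivity), so `p ∈ B ⊆ U`, while `p ∈ ∂U` and `U` is open. [folklore] -/
private theorem not_clusterPt_map_of_mem' {α β : Type*} [TopologicalSpace α] [TopologicalSpace β]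
    [RegularSpace α] {U : Set α} (hU : IsOpen U) {ψ : α → β} (hinj : InjOn ψ U)
    (hopen : ∀ B : Set α, IsOpen B → IsOpen (ψ '' (B ∩ U))) {p : α} (hp : p ∈ frontier U)
    {y₀ : α} (hy₀ : y₀ ∈ U) : ¬ ClusterPt (ψ y₀) (map ψ (𝓝[U] p)) := by
  intro hq
  obtain ⟨B, hBn, hBc, hBU⟩ := exists_mem_nhds_isClosed_subset (hU.mem_nhds hy₀)
  have hO : ψ '' (interior B ∩ U) ∈ 𝓝 (ψ y₀) :=
    (hopen _ isOpen_interior).mem_nhds ⟨y₀, ⟨mem_interior_iff_mem_nhds.2 hBn, hy₀⟩, rfl⟩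
  have hpB : p ∈ closure B := by
    rw [mem_closure_iff_nhds]
    intro W hW
    have hmem : ψ '' (W ∩ U) ∈ map ψ (𝓝[U] p) :=
      image_mem_map (Filter.inter_mem (mem_nhdsWithin_of_mem_nhds hW) self_mem_nhdsWithin)
    obtain ⟨z, hzO, hzW⟩ := (clusterPt_iff_nonempty.1 hq) hO hmem
    obtain ⟨b, ⟨hbB, hbU⟩, rfl⟩ := hzO
    obtain ⟨y, ⟨hyW, hyU⟩, hyb⟩ := hzW
    have hyb' : y = b := hinj hyU hbU hyb
    exact ⟨y, hyW, hyb' ▸ interior_subset hbB⟩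
  rw [hBc.closure_eq] at hpB
  have hpU : p ∈ interior U := by rw [hU.interior_eq]; exact hBU hpB
  exact hp.2 hpU

/-! ### The item from MGHD existence -/

/-! ### The item from MGHD existence -/

-- adapted from `Theorems/SwallowTheDatumSubdataDevelopmentsEmbedLocalisation.lean`
-- (`subdataDevelopmentsEmbed_of_choquetBruhatGeroch_of_causalCompact`: target restated over (D))
/-- **`SubdataDevelopmentsEmbed` from the existence of maximal globally hyperbolic vacuum
developments and the global hyperbolicity of Cauchy developments** (Hawking–Ellis 1973, §7.6,
p. 251; Choquet-Bruhat–Geroch 1969, p. 334): under the named facts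
`choquetBruhat_geroch_exists_mghd_cauchy` (Choquet-Bruhat–Geroch 1969, Thm. 3) and
`hawkingEllis_cauchyDevelopment_causalCompact_closed` (Hawking–Ellis 1973, Prop. 6.6.6; a theorem
of the tree, `…_holds`), every vacuum Cauchy development `𝒟'` of the sub-datum `Φ^* D` embeds
over `Φ` into every MAXIMAL vacuum Cauchy development `𝒟` of `D`. Proof: let `M̃` be a maximal
development of `Φ^* D` (the sub-datum is developable, by `𝒟'`; `N` inherits the Hausdorff and
second countability properties through the open embedding `Φ`), `R = (V, g|_V, ι ∘ Φ)` the domain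
of dependence of `ι(Φ N)` in `𝒟` (`exists_cauchyPieceDomain`), `θ : R → M̃` the embedding given
by maximality of `M̃`, `(U, ψ) = (θ(R), θ⁻¹)` the realised relative common sub-development of
`M̃` and `𝒟` (`exists_realised_into`). A cluster point `q` of `ψ` at `∂U` lies off the closure of
the bad set of `K = ι(X) ∖ ι(Φ N)` (`not_mem_closure_badSet_of_clusterPt`), hence in `V = ψ(U)` —
impossible (`not_clusterPt_map_of_mem`). So `Z = 𝒟 ∪_ψ M̃` is a vacuum Cauchy development of
`D` receiving `M̃` over `Φ` (`hglue_of_relGluing`); `Z` embeds into the maximal `𝒟`, and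
`𝒟' → M̃ → Z → 𝒟` is the embedding. [cite: HawkingEllis1973CUP, §7.6, pp. 249–251]
[cite: ChoquetBruhatGeroch1969CMP, Thm. 3 and p. 334] -/
theorem subdataDevelopmentsEmbedLit_of_choquetBruhatGeroch_of_causalCompact
    (hcbg : choquetBruhat_geroch_exists_mghd_cauchy)
    (hgh : hawkingEllis_cauchyDevelopment_causalCompact_closed) :
    SubdataDevelopmentsEmbedLit := by
  intro X _ _ _ _ _ _ D 𝒟 hmax N _ _ _ _ Φ hΦ hΦ' hΦo 𝒟'
  classical
  -- `N` is Hausdorff and second countable (open embedding into `X`)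
  haveI : T2Space N := hΦo.isEmbedding.t2Space
  haveI : SecondCountableTopology N := hΦo.isEmbedding.secondCountableTopology
  -- a maximal development `M` of the sub-datum
  obtain ⟨M, hM⟩ := exists_isMaximal_of_nonempty_of_choquetBruhatGeroch' hcbg N
    (D.comap Φ hΦ hΦ') ⟨𝒟'⟩
  -- the domain of dependence `V` of `ι(Φ N)` in `𝒟` and the development `R` of the sub-datum
  obtain ⟨n₀⟩ : Nonempty N := inferInstance
  have hslab : ∀ a ∈ range 𝒟.embed, ∃ ν : TangentSpace (𝓡 4) a,
      𝒟.metric.IsTimelike ν ∧ 𝒟.timeOrientation.IsFutureDirected ν ∧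
      ∀ κ : ℝ, 0 < κ → ∀ᶠ σ in 𝓝 a, σ ∈ range 𝒟.embed →
        |𝒟.metric.val a ν (extChartAt (𝓡 4) a σ - extChartAt (𝓡 4) a a)| ≤
          κ * ‖extChartAt (𝓡 4) a σ - extChartAt (𝓡 4) a a‖ := by
    rintro _ ⟨y, rfl⟩
    refine ⟨𝒟.normal y, ?_, 𝒟.isFutureUnitNormal.2 y, fun κ hκ ↦
      𝒟.toDataEmbedding.eventually_abs_val_normal_le y hκ⟩
    show 𝒟.metric.val _ (𝒟.normal y) (𝒟.normal y) < 0
    rw [𝒟.isFutureUnitNormal.1.2 y]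
    norm_num
  obtain ⟨V, -, hVc, hιV, hVcl, hVC⟩ := exists_cauchyPieceDomain 𝒟 hΦo hslab n₀
  have hν : ∀ u, MDifferentiableAt (𝓡 3) (𝓡 4).tangent
      (fun x ↦ (TotalSpace.mk' (EuclideanSpace ℝ (Fin 4)) (𝒟.embed x) (𝒟.normal x) :
        TangentBundle (𝓡 4) 𝒟.carrier)) (Φ u) := fun u ↦
    𝒟.toDataEmbedding.mdifferentiableAt_embed_normal (Φ u)
  have hVC' : (𝒟.metric.restrict PseudoRiemannianMetric.contMDiff_restrict_holds V).IsCauchyHypersurface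
      (𝒟.timeOrientation.restrict PseudoRiemannianMetric.contMDiff_restrict_holds
        𝒟.timeOrientation.contMDiff_restrict_holds V)
      (range ((𝒟.toDataEmbedding.comapAlong Φ hΦ hΦ' hΦo hν).embedOpens V hιV)) := by
    intro γ s hγ
    obtain ⟨t, ⟨hts, u, hu⟩, huniq⟩ := hVC γ s hγ
    refine ⟨t, ⟨hts, u, Subtype.ext hu⟩, fun t' ht' ↦ huniq t' ⟨ht'.1, ?_⟩⟩
    obtain ⟨u', hu'⟩ := ht'.2
    exact ⟨u', congrArg Subtype.val hu'⟩
  set R : VacuumCauchyDevelopment (D.comap Φ hΦ hΦ') :=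
    𝒟.comapAlongRestrict Φ hΦ hΦ' hΦo hν V hVc hιV hVC' with hR_def
  -- `θ : R → M` by maximality of `M`
  obtain ⟨θ, hθs, hθo, hθi, hθt, hθc⟩ := hM R
  -- the inclusion `k = Subtype.val : R → 𝒟` over `Φ`
  set k : R.carrier → 𝒟.carrier := fun y ↦ y.1 with hk_def
  have hks : ContMDiff (𝓡 4) (𝓡 4) ∞ k := contMDiff_subtype_val
  have hki : R.metric.IsIsometricImmersion 𝒟.metric.toPseudoRiemannianMetric k := by
    refine ⟨hks, fun y ↦ ?_⟩
    ext v w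
    rw [pullbackBilin_apply]
    change 𝒟.metric.val y.1 (mfderiv (𝓡 4) (𝓡 4) (Subtype.val : V → 𝒟.carrier) y v)
      (mfderiv (𝓡 4) (𝓡 4) (Subtype.val : V → 𝒟.carrier) y w) = 𝒟.metric.val y.1 v w
    rw [mfderiv_subtypeVal]
    rfl
  have hkt : R.timeOrientation.PreservesTimeOrientation k 𝒟.timeOrientation := fun y ↦ by
    change 𝒟.timeOrientation.IsFutureDirected
      (mfderiv (𝓡 4) (𝓡 4) (Subtype.val : V → 𝒟.carrier) y (𝒟.timeOrientation.vectorField y.1))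
    rw [mfderiv_subtypeVal]
    exact 𝒟.timeOrientation.isFutureDirected_vectorField y.1
  have hkc : k ∘ R.embed = 𝒟.embed ∘ Φ := rfl
  -- realise `R` inside `M` through `θ`: `(U, ψ) = (θ(R), val ∘ θ⁻¹)`
  obtain ⟨U, ψ, hP, hUeq, -, hψθ⟩ := exists_realised_into R.toCauchyDevelopment M.toCauchyDevelopment
    𝒟.toSpacetime (𝒟.embed ∘ Φ) hθs hθo hθi hθt hθc hks hki hkt hkc Subtype.val_injective
  -- the image `ψ(U)` is `V`
  have himage : ψ '' (U : Set M.carrier) = (V : Set 𝒟.carrier) := by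
    rw [hUeq]
    ext z
    constructor
    · rintro ⟨_, ⟨r, rfl⟩, rfl⟩
      rw [hψθ]
      exact r.2
    · intro hz
      exact ⟨θ ⟨z, hz⟩, ⟨⟨z, hz⟩, rfl⟩, by rw [hψθ]⟩
  -- global hyperbolicity of `𝒟` and `M` (theorems of the tree)
  obtain ⟨hK, hK', hrel⟩ := hgh X D 𝒟.toCauchyDevelopment
  obtain ⟨hK₁, hK₁', -⟩ := hgh N (D.comap Φ hΦ hΦ') M.toCauchyDevelopment
  -- no cluster values of `ψ` at the frontier of `U`
  haveI : LocallyCompactSpace M.carrier :=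
    ChartedSpace.locallyCompactSpace (EuclideanSpace ℝ (Fin 4)) M.carrier
  have hncb : ∀ p ∈ frontier (U : Set M.carrier), ∀ q : 𝒟.carrier,
      ¬ ClusterPt q (map ψ (𝓝[(U : Set M.carrier)] p)) := by
    intro p hp q hq
    obtain ⟨hqF, -, hinj, hopen, -⟩ := not_mem_closure_badSet_of_clusterPt 𝒟 hΦ hΦ' hΦo M
      hK hK' hK₁ hK₁' (fun hx hy hxy ↦ hrel _ _ _ _ hx hy hxy)
      hslab U ψ hP hp hq
    -- `q ∈ closure ψ(U) = closure V`, hence `q ∈ V = ψ(U)`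
    have hle : map ψ (𝓝[(U : Set M.carrier)] p) ≤ 𝓟 (ψ '' (U : Set M.carrier)) := by
      rw [← map_principal]
      exact map_mono (le_principal_iff.2 self_mem_nhdsWithin)
    have hqcl : q ∈ closure (ψ '' (U : Set M.carrier)) :=
      mem_closure_iff_clusterPt.2 (hq.mono hle)
    rw [himage] at hqcl
    have hqV : q ∈ (V : Set 𝒟.carrier) := hVcl ⟨hqcl, hqF⟩
    rw [← himage] at hqV
    obtain ⟨y₀, hy₀U, rfl⟩ := hqV
    exact not_clusterPt_map_of_mem' U.2 hinj hopen hp hy₀U hq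
  -- the gluing `Z = 𝒟 ∪_ψ M`, receiving `M` over `Φ`
  obtain ⟨Z, jZ, j', ⟨-, -, -, -, -⟩, ⟨hj's, hj'o, hj'i, hj't, hj'c⟩, -⟩ :=
    hglue_of_relGluing M 𝒟 hΦo.injective U ψ hP hncb
  -- maximality of `𝒟` absorbs `Z`; `𝒟'` embeds into `M`
  obtain ⟨ζ, hζs, hζo, hζi, hζt, hζc⟩ := hmax Z
  obtain ⟨χ', hχ's, hχ'o, hχ'i, hχ't, hχ'c⟩ := hM 𝒟'
  have hζj's : ContMDiff (𝓡 4) (𝓡 4) ∞ (ζ ∘ j') := hζs.comp hj's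
  have hζj'i : M.metric.IsIsometricImmersion 𝒟.metric.toPseudoRiemannianMetric (ζ ∘ j') :=
    hζi.comp hj'i
  refine ⟨(ζ ∘ j') ∘ χ', hζj's.comp hχ's, (hζo.comp hj'o).comp hχ'o, hζj'i.comp hχ'i,
    (hζt.comp hj't hζi.2 (hζs.mdifferentiable (by simp)) (hj's.mdifferentiable (by simp))).comp
      hχ't hζj'i.2 (hζj's.mdifferentiable (by simp)) (hχ's.mdifferentiable (by simp)), ?_⟩
  calc ((ζ ∘ j') ∘ χ') ∘ 𝒟'.embed = ζ ∘ j' ∘ (χ' ∘ 𝒟'.embed) := rfl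
    _ = ζ ∘ (j' ∘ M.embed) := by rw [hχ'c]
    _ = ζ ∘ (Z.embed ∘ Φ) := by rw [hj'c]
    _ = (ζ ∘ Z.embed) ∘ Φ := rfl
    _ = 𝒟.embed ∘ Φ := by rw [hζc]

/-- **(D) from MGHD existence alone**: `SubdataDevelopmentsEmbedLit` follows from the named fact
`choquetBruhat_geroch_exists_mghd_cauchy`, the global hyperbolicity input being the theorem
`hawkingEllis_cauchyDevelopment_causalCompact_closed_holds` of the tree. Hawking–Ellis 1973, §7.6,
p. 251. [cite: HawkingEllis1973CUP, §7.6, pp. 249–251] [cite: ChoquetBruhatGeroch1969CMP, Thm. 3 and p. 334] -/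
theorem subdataDevelopmentsEmbedLit_of_choquetBruhatGeroch
    (hcbg : choquetBruhat_geroch_exists_mghd_cauchy) : SubdataDevelopmentsEmbedLit :=
  subdataDevelopmentsEmbedLit_of_choquetBruhatGeroch_of_causalCompact hcbg
    hawkingEllis_cauchyDevelopment_causalCompact_closed_holds

end F1Route

open Literature.Geometry.Lorentzian F1Route in
/-- **Registered bookkeeping sub-goal `stub_subdataDevelopmentsEmbedLit` of the line** (brick of the
landing of F1' `stub_slabCauchyRigidity'`): route statement (D) `SubdataDevelopmentsEmbedLit` — the
localisation principle — holds conditionally on the MGHD existence fact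
`choquetBruhat_geroch_exists_mghd_cauchy` (Choquet-Bruhat–Geroch 1969, Thm. 3), the global
hyperbolicity input being the tree theorem `hawkingEllis_cauchyDevelopment_causalCompact_closed_holds`.
[cite: HawkingEllis1973CUP, §7.6, pp. 249–251] -/
theorem stub_subdataDevelopmentsEmbedLit :
    choquetBruhat_geroch_exists_mghd_cauchy → F1Route.SubdataDevelopmentsEmbedLit :=
  subdataDevelopmentsEmbedLit_of_choquetBruhatGeroch

end Summit.FinalStateConjecture.FinalStateConjecture.Theorems.BondiBartnikRigidity.DirectMethod

end
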